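/-
Origin: expansion seat `prover-pub-hodgecm-mc-sinst-1-g2-0`, handover #1203 r3 2026-08-20T01:21Z md5 d9818502ec96 (238 l.) NEW additive leaf — CONDITIONAL ROW (install after #1202 + theta-3 (E1) `Model/ArchLineInputOf`; skip if (E1) is not installed); SInstance.SA = S at A := fun V c k => archLineInputOf (𝔄 V c) k, (N1) read-backs in both archWeight currencies, hT_SA/hT_A hypothesis-free; drop alone on bounce (`HOME/mc/pub-hodgecm-mc-sinst-1-g2/stage/HodgeCM/Model/ThetaAdelicSideInstanceA.lean`, md5 d9818502ec96, 238 lines);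
landed by the second packager (p2) in gate run 38 as `HodgeCM/Model/ThetaAdelicSideInstanceA.lean` (verbatim).
-/
/-
HodgeCM/Model/ThetaAdelicSideInstanceA.lean — sinst-1 lane (unit pub-hodgecm-mc-sinst-1-g2, seat prover-pub-hodgecm-mc-sinst-1-g2-0,
2026-08-19/20), BINDER-OWNERS row 5 `S`: the `@A` SLOT OF THE TOTAL S FAMILY FILLED by theta-3's archimedean line inputs
(model1-g9 PATH ✓ provisional 2026-08-19T23:03:13Z; RUN 39+, strictly BEHIND theta-3's (E1) `HodgeCM/Model/ArchLineInputOf.lean`).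

  `SInstance.SA @hGR @η @hη @hηc @hGR₀ @hGR₁ @hGR₂ @hGR₃ @μ @𝔄 : ∀ {L ι₁} V c, ThetaAdelicSide V c`
      `:= SInstance.S … (fun V c k => archLineInputOf (𝔄 V c) k)`                       (ONE syntactic family term — the SAME argument text as
       binder-1's RUN-38+ #27 `Binders/Gen12PinsTotalA.lean` `gen12_totalAE 𝔄`, so the row-16 and row-13 discharges meet at one pin term)

over E's V-free weight binder `μ : ∀ {L}, SeesawCtx L → Fin 4 → InfinitePlace L → ℤ` and a datum family
`𝔄 : ∀ {L ι₁} V c, ArchSideTerm.ArchLineDatum V c.D (hGR V c) (hGR₀ V c) (hGR₁ V c) (hGR₂ V c) (hGR₃ V c) (η V c) (μ c)` (theta-3 `ArchLineInputOf`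
v0d: per line the archimedean test function / base point / centre eigenvalue and the two named hypotheses (D5-ctr)_k, (J-μ)_k; its honest
inhabitant = theta-3's RUN-39+ leaf `Model/ArchLineDatumOf.lean`, STATUS 2026-08-19T23:06:36Z).  After this leaf the S pin's open inputs are
EXACTLY: `hGR hGR₀ hGR₁ hGR₂ hGR₃` (cited [GelbartRogawski1991, Prop. 3.1.1 p. 455] `Prop`s, true for all data), `η hη hηc` (the twist
character shared with the W pin), `μ` (E's own binder) and `𝔄`.

§1 `SA`, `SA_eq_S` / `SA_apply` (rfl), and the (N1) read-back ON THE LINE DATA **`archLine_w : (archLineInputOf (𝔄 V c) k).w = ⇑(archWeight L (μ c k))`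
   — `rfl`, UNGUARDED, every `k : Fin 4`** (theta-3 `archLineInputOf_w` at E's `μ c k`); hence binder-1's guarded literal check `hN1g` of
   `Gen12Pins.gen12_totalE` (#26, any guard, k = 0, 1; = #27's `hN1g_archLine`) and the unguarded `hAw` of `gen12_pin_of_A` (#23) — stated here as
   `hN1g_SA` in a guard-GENERIC form (premise `P V c` arbitrary) and `hAw_SA`, so that a consumer re-bases by import only and this leaf imports no `Binders/*`.
§2 the S-side read-backs at `SA` under the sign guard `hdef : ⟨plane definite at ι₁⟩` (READ OFF any good context, #1201 §1):
   `SA_P_w hdef k : (((SA …) V c).P k).w = ⇑(archWeight L (μ c k))`, `SA_P_Φinf`, `SA_P_x₀`, `SA_eq_archSideOf hdef`,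
   `SA_eq_archSideOf_of_goodCtx`, `SA_eq_archSideOf_of_thetaModel_goodCtx`, and the archimedean weight identity (W-wt) = D5 AT THE PIN:
   `SA_P_weight hdef k N t : ((SA …).P k).ω (1, t_∞) φ_N = archWeight L (μ c k) t • φ_N` (the record's own field, weight literal).
§3 rows `hLF` / 13 `hT` at `SA`, HYPOTHESIS-FREE: `SInstance.hLF_SA`, `SInstance.hT_SA` (#1202 `SInstance.hLF` / `SInstance.hT`).

(A-tot) CAVEAT (model1-g9 23:03:13Z; binder-2's call): this leaf presumes `𝔄 V c` TOTAL in `(V, c)` (theta-3: data total; only the proof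
fields (J2) might want the GoodCtx sign facts).  If `𝔄` is ruled GoodCtx-only, the composed family is the sibling `SInstance.SG h … @AG`
over `HodgeCM/Model/ThetaAdelicSideGuarded.lean` (gen 0, 270f31a651d0, additive, not yet tabled) with `AG V c hc k := archLineInputOf (𝔄 V c hc) k`
— same API with `hc` for `hdef`; one import apart, filed on the ruling.

KERNEL ONLY: 0 records, 0 `def … : Prop`, nothing cited, MODEL-N ±0, E TYPE ±0 (the E binder `S` is instantiated, not changed).
-/
import Summits.HodgeConjecture.HodgeCM.Model.ThetaAdelicSideLF
import Summits.HodgeConjecture.HodgeCM.Model.ArchLineInputOf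

set_option autoImplicit false

noncomputable section

open scoped Matrix SchwartzMap
open NumberField NumberField.mixedEmbedding
open Literature.NumberTheory.Automorphic Literature.NumberTheory.Weil1964
open Literature.NumberTheory.GelbartRogawski1991.UnitaryDualPair
open HodgeCM.Adelic HodgeCM.PerL34
open Literature.Geometry.ComplexHyperbolic.BallModel (U21)
open Literature.AlgebraicGeometry.HodgeTheory
open Literature.NumberTheory.Automorphic.PicardCM

namespace HodgeCM.Model

namespace SInstance

open HodgeCM.Model.ArchSideTerm

variable
  (hGR : ∀ {L : CMField} {ι₁ : L →+* ℂ} (V : HermSpace3 L ι₁) (c : SeesawCtx L),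
    (cmSplittingDatum (L : Type) finProdFinEquiv (frameD V) (frameD_real V) (frameD_ne V) (dW c.D) (dW_real c.D)
      (dW_ne c.D)).CompatibleSplitting)
  (η : ∀ {L : CMField} {ι₁ : L →+* ℂ} (V : HermSpace3 L ι₁) (c : SeesawCtx L),
    CMAdelic (L : Type) (frameD V) × CMAdelic (L : Type) (dW c.D) →* ℂˣ)
  (hη : ∀ {L : CMField} {ι₁ : L →+* ℂ} (V : HermSpace3 L ι₁) (c : SeesawCtx L),
    ∀ γU ∈ CMRat (L : Type) (frameD V), ∀ γ ∈ CMRat (L : Type) (dW c.D), η V c (γU, γ) = 1)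
  (hηc : ∀ {L : CMField} {ι₁ : L →+* ℂ} (V : HermSpace3 L ι₁) (c : SeesawCtx L), Continuous fun p => ((η V c p : ℂˣ) : ℂ))
  (hGR₀ : ∀ {L : CMField} {ι₁ : L →+* ℂ} (V : HermSpace3 L ι₁) (c : SeesawCtx L),
    (cmSplittingDatum (L : Type) (e₁) (frameD V) (frameD_real V) (frameD_ne V) (lineVec (L : Type) (dW c.D 0))
      (fun _ => dW_real c.D 0) (fun _ => dW_ne c.D 0)).CompatibleSplitting)
  (hGR₁ : ∀ {L : CMField} {ι₁ : L →+* ℂ} (V : HermSpace3 L ι₁) (c : SeesawCtx L),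
    (cmSplittingDatum (L : Type) (e₁) (frameD V) (frameD_real V) (frameD_ne V) (lineVec (L : Type) (dW c.D 1))
      (fun _ => dW_real c.D 1) (fun _ => dW_ne c.D 1)).CompatibleSplitting)
  (hGR₂ : ∀ {L : CMField} {ι₁ : L →+* ℂ} (V : HermSpace3 L ι₁) (c : SeesawCtx L),
    (cmSplittingDatum (L : Type) (e₁) (frameD V) (frameD_real V) (frameD_ne V) (lineVec (L : Type) (dW' c.D 0))
      (fun _ => dW'_real c.D 0) (fun _ => dW'_ne c.D 0)).CompatibleSplitting)
  (hGR₃ : ∀ {L : CMField} {ι₁ : L →+* ℂ} (V : HermSpace3 L ι₁) (c : SeesawCtx L),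
    (cmSplittingDatum (L : Type) (e₁) (frameD V) (frameD_real V) (frameD_ne V) (lineVec (L : Type) (dW' c.D 1))
      (fun _ => dW'_real c.D 1) (fun _ => dW'_ne c.D 1)).CompatibleSplitting)
  (μ : ∀ {L : CMField}, SeesawCtx L → Fin 4 → NumberField.InfinitePlace L → ℤ)
  (𝔄 : ∀ {L : CMField} {ι₁ : L →+* ℂ} (V : HermSpace3 L ι₁) (c : SeesawCtx L),
    ArchLineDatum V c.D (hGR V c) (hGR₀ V c) (hGR₁ V c) (hGR₂ V c) (hGR₃ V c) (η V c) (μ c))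

/-! ## §1 The composed family -/

/-- **THE TOTAL HONEST S FAMILY WITH ITS ARCHIMEDEAN LINE INPUTS** — E's binder `S : ∀ {L ι₁} V c, ThetaAdelicSide V c` at
`A := fun V c k => archLineInputOf (𝔄 V c) k`: ONE syntactic family term (binder-1 #27's argument text), `@`-spelling for the other
family arguments (ELABORATION NOTE of `Binders/Gen12SeesawOfArchSide`). -/
abbrev SA : ∀ {L : CMField} {ι₁ : L →+* ℂ} (V : HermSpace3 L ι₁) (c : SeesawCtx L), ThetaAdelicSide V c :=
  S @hGR @η @hη @hηc @hGR₀ @hGR₁ @hGR₂ @hGR₃ (fun V c k => archLineInputOf (𝔄 V c) k)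

variable {L : CMField} {ι₁ : L →+* ℂ} (V : HermSpace3 L ι₁) (c : SeesawCtx L)

/-- read-back: `SA` IS `S` at the composed `A`-family (definitional; right side = binder-1 #27's pin text). -/
theorem SA_eq_S : SA @hGR @η @hη @hηc @hGR₀ @hGR₁ @hGR₂ @hGR₃ @μ @𝔄 V c =
    S @hGR @η @hη @hηc @hGR₀ @hGR₁ @hGR₂ @hGR₃ (fun V c k => archLineInputOf (𝔄 V c) k) V c := rfl

/-- read-back (definitional): the total term at the context. -/
theorem SA_apply : SA @hGR @η @hη @hηc @hGR₀ @hGR₁ @hGR₂ @hGR₃ @μ @𝔄 V c =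
    thetaAdelicSideOf V c (hGR V c) (hGR₀ V c) (hGR₁ V c) (hGR₂ V c) (hGR₃ V c) (η V c) (hη V c) (hηc V c)
      (fun k => archLineInputOf (𝔄 V c) k) := rfl

/-- **(N1) ON THE LINE DATA, UNGUARDED, every `k`**: the weight of line `k` IS `archWeight L (μ c k)` — `rfl` (theta-3 `archLineInputOf_w`,
restated at E's `μ c k`). -/
theorem archLine_w (k : Fin 4) :
    (archLineInputOf (𝔄 V c) k).w = ⇑(Literature.NumberTheory.Automorphic.archWeight (L : Type) (μ c k)) := rfl

/-- (Ported verbatim from the HodgeCMPerL package; no docstring in the source.) -/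
theorem archLine_w_apply (k : Fin 4) (t : ↥(Literature.NumberTheory.Automorphic.relNormOneInfUnits (↥(maximalRealSubfield L)) L)) :
    (archLineInputOf (𝔄 V c) k).w t = Literature.NumberTheory.Automorphic.archWeight (L : Type) (μ c k) t := rfl

/-- **binder-1's literal check `hN1g` / `hAw` DISCHARGED at the composed family, guard-generic**: for ANY premise family `P`
(E's `(pinT … W (SA …) μ).GoodCtx ι₁ c`, the recipe guard, …) and any side condition on `k`,
`∀ V c, P V c → ∀ k, Q k → (A V c k).w = ⇑(archWeight L (μ c k))` at `A := fun V c k => archLineInputOf (𝔄 V c) k` (up to β).  So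
`Gen12Pins.gen12_totalE … hN1g` re-bases with `hN1g := SInstance.hN1g_SA … (P := _) (Q := _)` (= binder-1 #27 `hN1g_archLine`). -/
theorem hN1g_SA (P : ∀ {L : CMField} {ι₁ : L →+* ℂ} (_V : HermSpace3 L ι₁) (_c : SeesawCtx L), Prop) (Q : Fin 4 → Prop) :
    ∀ {L : CMField} {ι₁ : L →+* ℂ} (V : HermSpace3 L ι₁) (c : SeesawCtx L), P V c → ∀ k : Fin 4, Q k →
      (archLineInputOf (𝔄 V c) k).w = ⇑(Literature.NumberTheory.Automorphic.archWeight (L : Type) (μ c k)) :=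
  fun _ _ _ _ _ => rfl

/-- the unguarded form (`hAw` of `Gen12Pins.gen12_pin_of_A`). -/
theorem hAw_SA : ∀ {L : CMField} {ι₁ : L →+* ℂ} (V : HermSpace3 L ι₁) (c : SeesawCtx L) (k : Fin 4),
    (archLineInputOf (𝔄 V c) k).w = ⇑(Literature.NumberTheory.Automorphic.archWeight (L : Type) (μ c k)) :=
  fun _ _ _ => rfl

/-- **E's literal currency** (`NumberField.archWeight`, the PKG `PerL34/SeesawTorus` weight used by binder-1's `hN1g` text and by E's
row-16 binder at the pins, glue-1 #363 `E2InstanceWS`): the same read-back, `rfl` across the two `archWeight`s (as binder-1 #27 `hN1g_archLine`). -/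
theorem archLine_w' (k : Fin 4) : (archLineInputOf (𝔄 V c) k).w = ⇑(NumberField.archWeight L (μ c k)) := rfl

/-- binder-1's guarded literal check in E's literal currency: `∀ V c, P V c → ∀ k, Q k → (A V c k).w = ⇑(NumberField.archWeight L (μ c k))`
at `A := fun V c k => archLineInputOf (𝔄 V c) k` — any premise family `P`, any side condition `Q`. -/
theorem hN1g_SA' (P : ∀ {L : CMField} {ι₁ : L →+* ℂ} (_V : HermSpace3 L ι₁) (_c : SeesawCtx L), Prop) (Q : Fin 4 → Prop) :
    ∀ {L : CMField} {ι₁ : L →+* ℂ} (V : HermSpace3 L ι₁) (c : SeesawCtx L), P V c → ∀ k : Fin 4, Q k →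
      (archLineInputOf (𝔄 V c) k).w = ⇑(NumberField.archWeight L (μ c k)) :=
  fun _ _ _ _ _ => rfl

/-- (N1) AT THE PIN in E's literal currency, under the sign guard. -/
theorem SA_P_w' (hdef : (∀ j, 0 < (ι₁ (dW c.D j)).re) ∨ ∀ j, (ι₁ (dW c.D j)).re < 0) (k : Fin 4) :
    (((SA @hGR @η @hη @hηc @hGR₀ @hGR₁ @hGR₂ @hGR₃ @μ @𝔄) V c).P k).w = ⇑(NumberField.archWeight L (μ c k)) :=
  thetaAdelicSideOf_P_w V c _ _ _ _ _ _ _ _ _ hdef k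

/-! ## §2 Read-backs at `SA` under the sign guard -/

/-- under the sign condition `SA … V c` IS period-1's term at the composed line inputs (`dif_pos`). -/
theorem SA_eq_archSideOf (hdef : (∀ j, 0 < (ι₁ (dW c.D j)).re) ∨ ∀ j, (ι₁ (dW c.D j)).re < 0) :
    SA @hGR @η @hη @hηc @hGR₀ @hGR₁ @hGR₂ @hGR₃ @μ @𝔄 V c =
      archSideOf V c (hGR V c) (hGR₀ V c) (hGR₁ V c) (hGR₂ V c) (hGR₃ V c) (η V c) (hη V c) (hηc V c) hdef
        (fun k => archLineInputOf (𝔄 V c) k) :=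
  thetaAdelicSideOf_eq_archSideOf V c _ _ _ _ _ _ _ _ _ hdef

/-- … at a good context of the recipe (any sign bit). -/
theorem SA_eq_archSideOf_of_goodCtx (h : Bool) (hc : SignRecipe.GoodCtx h ι₁ c) :
    SA @hGR @η @hη @hηc @hGR₀ @hGR₁ @hGR₂ @hGR₃ @μ @𝔄 V c =
      archSideOf V c (hGR V c) (hGR₀ V c) (hGR₁ V c) (hGR₂ V c) (hGR₃ V c) (η V c) (hη V c) (hηc V c)
        (dW_definite_of_goodCtx ι₁ c h hc) (fun k => archLineInputOf (𝔄 V c) k) :=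
  SA_eq_archSideOf @hGR @η @hη @hηc @hGR₀ @hGR₁ @hGR₂ @hGR₃ @μ @𝔄 V c _

/-- … at a good context of the END STATE of any core (E's guard `(pinT … W S μ).GoodCtx ι₁ c`, `pinT_eq_thetaModel` rfl). -/
theorem SA_eq_archSideOf_of_thetaModel_goodCtx {U : Universe} {hP : PrintFact_unitaryCompact} (C : U.AdelicThetaCore hP) (h : Bool)
    (d12 d34 : ∀ {L : CMField}, SeesawCtx L → Universe.SideData L) (hc : (C.thetaModel h d12 d34).GoodCtx ι₁ c) :
    SA @hGR @η @hη @hηc @hGR₀ @hGR₁ @hGR₂ @hGR₃ @μ @𝔄 V c =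
      archSideOf V c (hGR V c) (hGR₀ V c) (hGR₁ V c) (hGR₂ V c) (hGR₃ V c) (η V c) (hη V c) (hηc V c)
        (dW_definite_of_thetaModel_goodCtx ι₁ c C h d12 d34 hc) (fun k => archLineInputOf (𝔄 V c) k) :=
  SA_eq_archSideOf @hGR @η @hη @hηc @hGR₀ @hGR₁ @hGR₂ @hGR₃ @μ @𝔄 V c _

/-- **(N1) AT THE PIN under the sign guard**: `((SA … V c).P k).w = ⇑(archWeight L (μ c k))` (sinst-1 `thetaAdelicSideOf_P_w` ∘ theta-3
`archLineInputOf_w`) — binder-1's `ST_P_w` with the right-hand side already in (N1) shape. -/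
theorem SA_P_w (hdef : (∀ j, 0 < (ι₁ (dW c.D j)).re) ∨ ∀ j, (ι₁ (dW c.D j)).re < 0) (k : Fin 4) :
    (((SA @hGR @η @hη @hηc @hGR₀ @hGR₁ @hGR₂ @hGR₃ @μ @𝔄) V c).P k).w = ⇑(Literature.NumberTheory.Automorphic.archWeight (L : Type) (μ c k)) :=
  thetaAdelicSideOf_P_w V c _ _ _ _ _ _ _ _ _ hdef k

/-- (Ported verbatim from the HodgeCMPerL package; no docstring in the source.) -/
theorem SA_P_w_apply (hdef : (∀ j, 0 < (ι₁ (dW c.D j)).re) ∨ ∀ j, (ι₁ (dW c.D j)).re < 0) (k : Fin 4)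
    (t : ↥(Literature.NumberTheory.Automorphic.relNormOneInfUnits (↥(maximalRealSubfield L)) L)) :
    (((SA @hGR @η @hη @hηc @hGR₀ @hGR₁ @hGR₂ @hGR₃ @μ @𝔄) V c).P k).w t = Literature.NumberTheory.Automorphic.archWeight (L : Type) (μ c k) t := by
  rw [SA_P_w @hGR @η @hη @hηc @hGR₀ @hGR₁ @hGR₂ @hGR₃ @μ @𝔄 V c hdef k]

/-- (N1) at the pin, read at a good context of the END STATE of any core (E's guard). -/
theorem SA_P_w_of_thetaModel_goodCtx {U : Universe} {hP : PrintFact_unitaryCompact} (C : U.AdelicThetaCore hP) (h : Bool)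
    (d12 d34 : ∀ {L : CMField}, SeesawCtx L → Universe.SideData L) (hc : (C.thetaModel h d12 d34).GoodCtx ι₁ c) (k : Fin 4) :
    (((SA @hGR @η @hη @hηc @hGR₀ @hGR₁ @hGR₂ @hGR₃ @μ @𝔄) V c).P k).w = ⇑(Literature.NumberTheory.Automorphic.archWeight (L : Type) (μ c k)) :=
  SA_P_w @hGR @η @hη @hηc @hGR₀ @hGR₁ @hGR₂ @hGR₃ @μ @𝔄 V c (dW_definite_of_thetaModel_goodCtx ι₁ c C h d12 d34 hc) k

/-- the archimedean test function of line `k` at the pin is the datum's `Φinf k`. -/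
theorem SA_P_Φinf (hdef : (∀ j, 0 < (ι₁ (dW c.D j)).re) ∨ ∀ j, (ι₁ (dW c.D j)).re < 0) (k : Fin 4) :
    (((SA @hGR @η @hη @hηc @hGR₀ @hGR₁ @hGR₂ @hGR₃ @μ @𝔄) V c).P k).Φinf = (𝔄 V c).Φinf k :=
  thetaAdelicSideOf_P_Φinf V c _ _ _ _ _ _ _ _ _ hdef k

/-- the base point of line `k` at the pin is the datum's `x₀ k`. -/
theorem SA_P_x₀ (hdef : (∀ j, 0 < (ι₁ (dW c.D j)).re) ∨ ∀ j, (ι₁ (dW c.D j)).re < 0) (k : Fin 4) :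
    (((SA @hGR @η @hη @hηc @hGR₀ @hGR₁ @hGR₂ @hGR₃ @μ @𝔄) V c).P k).x₀ = (𝔄 V c).x₀ k :=
  thetaAdelicSideOf_P_x₀ V c _ _ _ _ _ _ _ _ _ hdef k

/-- `(P k).ω = lineRepOf … k` at the pin under the guard (period-1 (J5)). -/
theorem SA_P_ω (hdef : (∀ j, 0 < (ι₁ (dW c.D j)).re) ∨ ∀ j, (ι₁ (dW c.D j)).re < 0) (k : Fin 4) :
    (((SA @hGR @η @hη @hηc @hGR₀ @hGR₁ @hGR₂ @hGR₃ @μ @𝔄) V c).P k).ω =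
      lineRepOf V c.D (hGR V c) (hGR₀ V c) (hGR₁ V c) (hGR₂ V c) (hGR₃ V c)
        (eta₀ V c.D (η V c)) (eta₁ V c.D (η V c)) (eta₂ V c.D (η V c)) (eta₃ V c.D (η V c)) k :=
  thetaAdelicSideOf_P_ω V c _ _ _ _ _ _ _ _ _ hdef k

/-- **(W-wt) = D5 AT THE PIN with the weight LITERAL**: under the guard, the archimedean norm-one torus acts on the pinned test vector
`φ_N` of line `k` by `archWeight L (μ c k)` (the record's own `weight` field read through `SA_P_w`). -/
theorem SA_P_weight (hdef : (∀ j, 0 < (ι₁ (dW c.D j)).re) ∨ ∀ j, (ι₁ (dW c.D j)).re < 0) (k : Fin 4) (N : ℕ)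
    (t : ↥(Literature.NumberTheory.Automorphic.relNormOneInfUnits (↥(maximalRealSubfield L)) L)) :
    (((SA @hGR @η @hη @hηc @hGR₀ @hGR₁ @hGR₂ @hGR₃ @μ @𝔄) V c).P k).ω
        (1, Literature.NumberTheory.Automorphic.relNormOneInfToIdeles (↥(maximalRealSubfield L)) L t)
        (SupplyInstance.testFun (↥(maximalRealSubfield L)) (Fin 3)
          (((SA @hGR @η @hη @hηc @hGR₀ @hGR₁ @hGR₂ @hGR₃ @μ @𝔄) V c).P k).Φinf
          (((SA @hGR @η @hη @hηc @hGR₀ @hGR₁ @hGR₂ @hGR₃ @μ @𝔄) V c).P k).x₀ N) =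
      Literature.NumberTheory.Automorphic.archWeight (L : Type) (μ c k) t •
        SupplyInstance.testFun (↥(maximalRealSubfield L)) (Fin 3)
          (((SA @hGR @η @hη @hηc @hGR₀ @hGR₁ @hGR₂ @hGR₃ @μ @𝔄) V c).P k).Φinf
          (((SA @hGR @η @hη @hηc @hGR₀ @hGR₁ @hGR₂ @hGR₃ @μ @𝔄) V c).P k).x₀ N := by
  rw [← SA_P_w_apply @hGR @η @hη @hηc @hGR₀ @hGR₁ @hGR₂ @hGR₃ @μ @𝔄 V c hdef k t]
  exact (((SA @hGR @η @hη @hηc @hGR₀ @hGR₁ @hGR₂ @hGR₃ @μ @𝔄) V c).P k).weight N t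

/-! ## §3 Rows `hLF` / 13 `hT` at `SA`, hypothesis-free -/

/-- **E's binder `hLF` at `SA`**, no hypothesis (#1202 `SInstance.hLF` at the composed `A`-family). -/
theorem hLF_SA : ∀ {L : CMField} {ι₁ : L →+* ℂ} (V : HermSpace3 L ι₁) (c : SeesawCtx L) (k : Fin 4),
    ((SA @hGR @η @hη @hηc @hGR₀ @hGR₁ @hGR₂ @hGR₃ @μ @𝔄 V c).P k).IsLFAction :=
  hLF @hGR @η @hη @hηc @hGR₀ @hGR₁ @hGR₂ @hGR₃ (fun V c k => archLineInputOf (𝔄 V c) k)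

/-- **E's row-13 binder `hT` at `SA`**, no hypothesis: `∀ V c k N, ((SA … V c).P k).IsThetaArchContinuous N`. -/
theorem hT_SA : ∀ {L : CMField} {ι₁ : L →+* ℂ} (V : HermSpace3 L ι₁) (c : SeesawCtx L) (k : Fin 4) (N : ℕ),
    ((SA @hGR @η @hη @hηc @hGR₀ @hGR₁ @hGR₂ @hGR₃ @μ @𝔄 V c).P k).IsThetaArchContinuous N :=
  hT @hGR @η @hη @hηc @hGR₀ @hGR₁ @hGR₂ @hGR₃ (fun V c k => archLineInputOf (𝔄 V c) k)

/-- `hLF` at the LITERAL pin text `S … (fun V c k => archLineInputOf (𝔄 V c) k)` (binder-1 #27's spelling; = `hLF_SA` by `rfl`). -/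
theorem hLF_A : ∀ {L : CMField} {ι₁ : L →+* ℂ} (V : HermSpace3 L ι₁) (c : SeesawCtx L) (k : Fin 4),
    ((S @hGR @η @hη @hηc @hGR₀ @hGR₁ @hGR₂ @hGR₃ (fun V c k => archLineInputOf (𝔄 V c) k) V c).P k).IsLFAction :=
  hLF @hGR @η @hη @hηc @hGR₀ @hGR₁ @hGR₂ @hGR₃ (fun V c k => archLineInputOf (𝔄 V c) k)

/-- **E's row-13 binder `hT` at the LITERAL pin text** `S … (fun V c k => archLineInputOf (𝔄 V c) k)` (= `hT_SA` by `rfl`). -/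
theorem hT_A : ∀ {L : CMField} {ι₁ : L →+* ℂ} (V : HermSpace3 L ι₁) (c : SeesawCtx L) (k : Fin 4) (N : ℕ),
    ((S @hGR @η @hη @hηc @hGR₀ @hGR₁ @hGR₂ @hGR₃ (fun V c k => archLineInputOf (𝔄 V c) k) V c).P k).IsThetaArchContinuous N :=
  hT @hGR @η @hη @hηc @hGR₀ @hGR₁ @hGR₂ @hGR₃ (fun V c k => archLineInputOf (𝔄 V c) k)

end SInstance

end HodgeCM.Model

end
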